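import Mathlib
import HarnessLib
import Literature.Analysis.FluidPDE.TypeIAncientMild
import Literature.Analysis.FluidPDE.KochTataruKernel
import Literature.Analysis.FluidPDE.ChaeWolfRemovingDSSBounds
import Literature.Analysis.UnboundedOperators.HeatExtensionDecay
import Literature.Analysis.UnboundedOperators.HeatKernelBoundedData

/-!
# Route `PoloidalWindowDoor`, crux `PoloidalWindowRigidity` (stmt-NavierStokesRegularity-19708) — LINE 23 «eternal_core» v1.0
# (ns-idea-8 g11, `Cruxes/PoloidalWindowRigidity/Lines/eternal_core.lean` 2a19051e6b6d; idea-crit-7 g7 PASS): TOOLS for the hand stub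
# U2b `stub_paraboloidGap : ParaboloidGap` — the three localisation estimates of the paraboloid gap

Seat ns-es-p1 g8 (free prover hand on ⟨19708⟩; CLAIM announced on the ideators bus before proposing).  Pure analysis lemmas
(Mathlib + Literature only, no route cone):

* `integrableOn_rpow_quarter_sub`, `integral_rpow_quarter_sub` — the time weight of the FAR FIELD,
  `∫_{4s}^{s} (s − r)^{−1/4} dr = (4/3)(−3s)^{3/4}`;
* `norm_heatExtension_le_of_ball_bound` — **caloric term with a controlled ball and a Markov tail**: if `‖g‖ ≤ B` everywhere and
  `‖g(x − y)‖ ≤ A` for `‖y‖ ≤ d`, then `‖e^{tΔ}g (x)‖ ≤ A + (B/d)·8√t` (mass one of the heat kernel + its FIRST MOMENT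
  `∫ G_t(y)‖y‖ dy ≤ 2·2^{3/2}√t`, `Literature…integral_heatKernel_mul_norm_le`; `𝟙_{‖y‖>d} ≤ ‖y‖/d`) — no Gaussian tail needed;
* `norm_integral_oseenKernel_le_split` — **spatial Oseen integral with a near/far split**: under Koch–Tataru's pointwise bound (14)
  `‖K(τ,z)[a,b]‖ ≤ K(τ+‖z‖²)^{−2}‖a‖‖b‖` (tree: `exists_norm_oseenKernel_le`, d = 3), if `‖f y‖ ≤ A` for `‖x − y‖ ≤ d` and `‖f‖ ≤ B`
  everywhere, then `‖∫ K(τ, x−y)[f y, f y] dy‖ ≤ K M₀ τ^{−1/2} A² + K M₁ (d²)^{−1/4} τ^{−1/4} B²`, `M₀ = ∫(1+‖w‖²)^{−2}`,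
  `M₁ = ∫(1+‖w‖²)^{−7/4}` — the far field through `(τ+u²)^{−2} ≤ (d²)^{−1/4}(τ+u²)^{−7/4}` for `u ≥ d` and the scaling law
  `integral_add_norm_sq_rpow_neg` (integrable since `3 < 2·(7/4)`).

HONEST LABEL: tools for ONE support stub of a files-only PASSed line; nothing here closes a cell, a crux or a route item; ⟨19708⟩ /
⟨20428⟩ and NS regularity stay OPEN — no summit statement is proved here.
-/

noncomputable section

-- the summit and its single sub-problem share the name (CONVENTIONS §1), as in every Theorems file
set_option linter.dupNamespace false

namespace Summit.NavierStokesRegularity.NavierStokesRegularity.Theorems.PoloidalWindowDoorPoloidalWindowRigidityEternalCoreParaboloidGapTools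

open Set Function Filter MeasureTheory
open Literature.Analysis Literature.Analysis.FluidPDE Literature.Analysis.UnboundedOperators

/-! ## The far-field time weight `∫_{4s}^{s} (s − r)^{−1/4} dr` -/

/-- For `s < 0` the weight `r ↦ (s − r)^{−1/4}` is integrable on `(4s, s)`. -/
theorem integrableOn_rpow_quarter_sub {s : ℝ} (hs : s < 0) :
    IntegrableOn (fun r : ℝ => (s - r) ^ (-(1 / 4 : ℝ))) (Ioo (4 * s) s) := by
  have h4 : 4 * s ≤ s := by linarith
  have hII : IntervalIntegrable (fun x : ℝ => x ^ (-(1 / 4 : ℝ))) volume (-(3 * s)) 0 :=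
    intervalIntegral.intervalIntegrable_rpow' (by norm_num)
  have hc := hII.comp_sub_left s
  have e1 : s - -(3 * s) = 4 * s := by ring
  have e2 : s - 0 = s := by ring
  rw [e1, e2] at hc
  exact (intervalIntegrable_iff_integrableOn_Ioo_of_le h4).1 hc

/-- `∫_{(4s, s)} (s − r)^{−1/4} dr = (4/3)·(−3s)^{3/4}` for `s < 0`. -/
theorem integral_rpow_quarter_sub {s : ℝ} (hs : s < 0) :
    ∫ r in Ioo (4 * s) s, (s - r) ^ (-(1 / 4 : ℝ)) = 4 / 3 * (-(3 * s)) ^ (3 / 4 : ℝ) := by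
  have h4 : 4 * s ≤ s := by linarith
  rw [← integral_Ioc_eq_integral_Ioo, ← intervalIntegral.integral_of_le h4,
    intervalIntegral.integral_comp_sub_left (fun x : ℝ => x ^ (-(1 / 4 : ℝ))) s]
  have e1 : s - s = 0 := by ring
  have e2 : s - 4 * s = -(3 * s) := by ring
  rw [e1, e2, integral_rpow (Or.inl (by norm_num))]
  have e3 : (-(1 / 4 : ℝ)) + 1 = 3 / 4 := by norm_num
  rw [e3, Real.zero_rpow (by norm_num), sub_zero]
  ring

/-! ## The caloric term with a controlled ball -/

/-- **Caloric term, controlled ball + Markov tail.**  If `‖g‖ ≤ B` everywhere and `‖g (x − y)‖ ≤ A` whenever `‖y‖ ≤ d` (`d > 0`,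
`A ≥ 0`), then `‖e^{tΔ} g (x)‖ ≤ A + (B/d)·(8√t)`: on `‖y‖ ≤ d` the heat kernel has mass `≤ 1`, and on `‖y‖ > d` one has
`1 ≤ ‖y‖/d`, so the tail is bounded by the first moment `∫ G_t(y)‖y‖ dy ≤ 2·2^{3/2}√t ≤ 8√t` (d = 3). -/
theorem norm_heatExtension_le_of_ball_bound {g : EuclideanSpace ℝ (Fin 3) → EuclideanSpace ℝ (Fin 3)} {A B d t : ℝ}
    (ht : 0 < t) (hd : 0 < d) (hA0 : 0 ≤ A) (hB : ∀ z, ‖g z‖ ≤ B) (x : EuclideanSpace ℝ (Fin 3))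
    (hA : ∀ y : EuclideanSpace ℝ (Fin 3), ‖y‖ ≤ d → ‖g (x - y)‖ ≤ A) :
    ‖heatExtension g t x‖ ≤ A + B / d * (8 * Real.sqrt t) := by
  have hB0 : 0 ≤ B := (norm_nonneg _).trans (hB 0)
  rw [heatExtension_apply]
  have hK : Integrable (heatKernel (E := EuclideanSpace ℝ (Fin 3)) t) := integrable_heatKernel_holds ht
  have hKn : Integrable (fun y : EuclideanSpace ℝ (Fin 3) => heatKernel t y * ‖y‖) := integrable_heatKernel_mul_norm ht
  have hdom : Integrable (fun y : EuclideanSpace ℝ (Fin 3) => heatKernel t y * A + B / d * (heatKernel t y * ‖y‖)) :=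
    (hK.mul_const A).add (hKn.const_mul _)
  have hpt : ∀ y : EuclideanSpace ℝ (Fin 3),
      ‖heatKernel t y • g (x - y)‖ ≤ heatKernel t y * A + B / d * (heatKernel t y * ‖y‖) := by
    intro y
    have hG := (heatKernel_pos ht y).le
    rw [norm_smul, Real.norm_of_nonneg hG]
    rcases le_or_gt ‖y‖ d with hy | hy
    · have h1 : heatKernel t y * ‖g (x - y)‖ ≤ heatKernel t y * A := mul_le_mul_of_nonneg_left (hA y hy) hG
      have h2 : 0 ≤ B / d * (heatKernel t y * ‖y‖) := by positivity
      linarith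
    · have h1 : ‖g (x - y)‖ ≤ B / d * ‖y‖ := by
        rw [div_mul_eq_mul_div, le_div_iff₀ hd]
        calc ‖g (x - y)‖ * d ≤ B * d := mul_le_mul_of_nonneg_right (hB _) hd.le
          _ ≤ B * ‖y‖ := mul_le_mul_of_nonneg_left hy.le hB0
      have h2 : heatKernel t y * ‖g (x - y)‖ ≤ heatKernel t y * (B / d * ‖y‖) := mul_le_mul_of_nonneg_left h1 hG
      have h3 : 0 ≤ heatKernel t y * A := mul_nonneg hG hA0
      calc heatKernel t y * ‖g (x - y)‖ ≤ heatKernel t y * (B / d * ‖y‖) := h2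
        _ = B / d * (heatKernel t y * ‖y‖) := by ring
        _ ≤ heatKernel t y * A + B / d * (heatKernel t y * ‖y‖) := le_add_of_nonneg_left h3
  refine (norm_integral_le_of_norm_le hdom (Eventually.of_forall hpt)).trans ?_
  rw [integral_add (hK.mul_const A) (hKn.const_mul _), integral_mul_const, integral_const_mul,
    integral_heatKernel_eq_one_holds ht, one_mul]
  have hmom := integral_heatKernel_mul_norm_le (E := EuclideanSpace ℝ (Fin 3)) ht
  have finrank_R3_real : ((Module.finrank ℝ (EuclideanSpace ℝ (Fin 3)) : ℕ) : ℝ) = 3 := by simp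
  rw [finrank_R3_real] at hmom
  -- `2 · 2^{3/2} · t^{1/2} ≤ 8 √t`
  have h232 : (2 : ℝ) ^ ((3 : ℝ) / 2) ≤ 4 := by
    have h : (2 : ℝ) ^ ((3 : ℝ) / 2) ≤ (2 : ℝ) ^ (2 : ℝ) :=
      Real.rpow_le_rpow_of_exponent_le (by norm_num) (by norm_num)
    have h2 : (2 : ℝ) ^ (2 : ℝ) = 4 := by norm_num
    linarith
  have hsq : t ^ (1 / 2 : ℝ) = Real.sqrt t := by rw [Real.sqrt_eq_rpow]
  rw [hsq] at hmom
  have hst : 0 ≤ Real.sqrt t := Real.sqrt_nonneg _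
  have hmom' : ∫ y : EuclideanSpace ℝ (Fin 3), heatKernel t y * ‖y‖ ≤ 8 * Real.sqrt t := by
    calc ∫ y : EuclideanSpace ℝ (Fin 3), heatKernel t y * ‖y‖ ≤ 2 * (2 : ℝ) ^ ((3 : ℝ) / 2) * Real.sqrt t := hmom
      _ ≤ 2 * 4 * Real.sqrt t := by gcongr
      _ = 8 * Real.sqrt t := by ring
  have hBd : 0 ≤ B / d := div_nonneg hB0 hd.le
  have := mul_le_mul_of_nonneg_left hmom' hBd
  linarith

/-! ## The spatial Oseen integral with a near/far split -/

/-- Far-field comparison of the Koch–Tataru weight: for `u ≥ d > 0`, `(τ + u²)^{−2} ≤ (d²)^{−1/4} (τ + u²)^{−7/4}`. -/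
theorem rpow_neg_two_le_far {τ u d : ℝ} (hτ : 0 < τ) (hd : 0 < d) (hu : d ≤ u) :
    (τ + u ^ 2) ^ (-(2 : ℝ)) ≤ (d ^ 2) ^ (-(1 / 4 : ℝ)) * (τ + u ^ 2) ^ (-(7 / 4 : ℝ)) := by
  have hpos : 0 < τ + u ^ 2 := by positivity
  have hsplit : (τ + u ^ 2) ^ (-(2 : ℝ)) = (τ + u ^ 2) ^ (-(1 / 4 : ℝ)) * (τ + u ^ 2) ^ (-(7 / 4 : ℝ)) := by
    rw [← Real.rpow_add hpos]; norm_num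
  rw [hsplit]
  have hd2 : 0 < d ^ 2 := by positivity
  have hle : d ^ 2 ≤ τ + u ^ 2 := by nlinarith
  have h1 : (τ + u ^ 2) ^ (-(1 / 4 : ℝ)) ≤ (d ^ 2) ^ (-(1 / 4 : ℝ)) :=
    Real.rpow_le_rpow_of_nonpos hd2 hle (by norm_num)
  exact mul_le_mul_of_nonneg_right h1 (Real.rpow_nonneg hpos.le _)

/-- **Spatial Oseen integral, near/far split.**  Under Koch–Tataru's bound (14) in dimension three, if `‖f y‖ ≤ A` on the ball
`‖x − y‖ ≤ d` and `‖f y‖ ≤ B` everywhere, then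
`‖∫ K(τ, x − y)[f y, f y] dy‖ ≤ K M₀ τ^{−1/2} A² + K M₁ (d²)^{−1/4} τ^{−1/4} B²`
with `M₀ = ∫(1+‖w‖²)^{−2}`, `M₁ = ∫(1+‖w‖²)^{−7/4}` (both finite in dimension three). -/
theorem norm_integral_oseenKernel_le_split {K : ℝ}
    (hK : ∀ {τ : ℝ}, 0 < τ → ∀ z a b : EuclideanSpace ℝ (Fin 3),
      ‖oseenKernel τ z a b‖ ≤ K * (τ + ‖z‖ ^ 2) ^ (-(2 : ℝ)) * ‖a‖ * ‖b‖)
    (hK0 : 0 ≤ K) {τ : ℝ} (hτ : 0 < τ) (x : EuclideanSpace ℝ (Fin 3))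
    {f : EuclideanSpace ℝ (Fin 3) → EuclideanSpace ℝ (Fin 3)} {A B d : ℝ} (hd : 0 < d) (hA0 : 0 ≤ A)
    (hA : ∀ y, ‖x - y‖ ≤ d → ‖f y‖ ≤ A) (hB : ∀ y, ‖f y‖ ≤ B) :
    ‖∫ y, oseenKernel τ (x - y) (f y) (f y)‖ ≤
      K * (∫ w : EuclideanSpace ℝ (Fin 3), (1 + ‖w‖ ^ 2) ^ (-(2 : ℝ))) * τ ^ (-(1 / 2 : ℝ)) * A ^ 2 +
        K * (∫ w : EuclideanSpace ℝ (Fin 3), (1 + ‖w‖ ^ 2) ^ (-(7 / 4 : ℝ))) *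
          (d ^ 2) ^ (-(1 / 4 : ℝ)) * τ ^ (-(1 / 4 : ℝ)) * B ^ 2 := by
  have hB0 : 0 ≤ B := (norm_nonneg _).trans (hB x)
  have finrank_R3_real : ((Module.finrank ℝ (EuclideanSpace ℝ (Fin 3)) : ℕ) : ℝ) = 3 := by simp
  have he2 : ((Module.finrank ℝ (EuclideanSpace ℝ (Fin 3)) : ℕ) : ℝ) < 2 * 2 := by
    rw [finrank_R3_real]; norm_num
  have he74 : ((Module.finrank ℝ (EuclideanSpace ℝ (Fin 3)) : ℕ) : ℝ) < 2 * (7 / 4 : ℝ) := by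
    rw [finrank_R3_real]; norm_num
  have hw2 : Integrable (fun y : EuclideanSpace ℝ (Fin 3) => (τ + ‖x - y‖ ^ 2) ^ (-(2 : ℝ))) :=
    (integrable_add_norm_sq_rpow_neg he2 hτ).comp_sub_left x
  have hw74 : Integrable (fun y : EuclideanSpace ℝ (Fin 3) => (τ + ‖x - y‖ ^ 2) ^ (-(7 / 4 : ℝ))) :=
    (integrable_add_norm_sq_rpow_neg he74 hτ).comp_sub_left x
  set g : EuclideanSpace ℝ (Fin 3) → ℝ := fun y =>
    K * A ^ 2 * (τ + ‖x - y‖ ^ 2) ^ (-(2 : ℝ)) +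
      K * B ^ 2 * (d ^ 2) ^ (-(1 / 4 : ℝ)) * (τ + ‖x - y‖ ^ 2) ^ (-(7 / 4 : ℝ)) with hg
  have hg_int : Integrable g := (hw2.const_mul _).add (hw74.const_mul _)
  have hbound : ∀ y, ‖oseenKernel τ (x - y) (f y) (f y)‖ ≤ g y := by
    intro y
    have h1 := hK hτ (x - y) (f y) (f y)
    have hwnn : 0 ≤ (τ + ‖x - y‖ ^ 2) ^ (-(2 : ℝ)) := Real.rpow_nonneg (by positivity) _
    have hwnn' : 0 ≤ (τ + ‖x - y‖ ^ 2) ^ (-(7 / 4 : ℝ)) := Real.rpow_nonneg (by positivity) _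
    have hfirst : 0 ≤ K * A ^ 2 * (τ + ‖x - y‖ ^ 2) ^ (-(2 : ℝ)) := by positivity
    have hsecond : 0 ≤ K * B ^ 2 * (d ^ 2) ^ (-(1 / 4 : ℝ)) * (τ + ‖x - y‖ ^ 2) ^ (-(7 / 4 : ℝ)) := by
      have : 0 ≤ (d ^ 2) ^ (-(1 / 4 : ℝ)) := Real.rpow_nonneg (by positivity) _
      positivity
    rcases le_or_gt ‖x - y‖ d with hy | hy
    · -- near field
      calc ‖oseenKernel τ (x - y) (f y) (f y)‖
          ≤ K * (τ + ‖x - y‖ ^ 2) ^ (-(2 : ℝ)) * ‖f y‖ * ‖f y‖ := h1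
        _ ≤ K * (τ + ‖x - y‖ ^ 2) ^ (-(2 : ℝ)) * A * A := by
            gcongr
            · exact hA y hy
            · exact hA y hy
        _ = K * A ^ 2 * (τ + ‖x - y‖ ^ 2) ^ (-(2 : ℝ)) := by ring
        _ ≤ g y := le_add_of_nonneg_right hsecond
    · -- far field
      have hfar := rpow_neg_two_le_far (τ := τ) hτ hd hy.le
      calc ‖oseenKernel τ (x - y) (f y) (f y)‖
          ≤ K * (τ + ‖x - y‖ ^ 2) ^ (-(2 : ℝ)) * ‖f y‖ * ‖f y‖ := h1
        _ ≤ K * (τ + ‖x - y‖ ^ 2) ^ (-(2 : ℝ)) * B * B := by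
            gcongr
            · exact hB y
            · exact hB y
        _ ≤ K * ((d ^ 2) ^ (-(1 / 4 : ℝ)) * (τ + ‖x - y‖ ^ 2) ^ (-(7 / 4 : ℝ))) * B * B := by
            gcongr
        _ = K * B ^ 2 * (d ^ 2) ^ (-(1 / 4 : ℝ)) * (τ + ‖x - y‖ ^ 2) ^ (-(7 / 4 : ℝ)) := by ring
        _ ≤ g y := le_add_of_nonneg_left hfirst
  refine (norm_integral_le_of_norm_le hg_int (Eventually.of_forall hbound)).trans ?_
  have hsub2 : ∫ y : EuclideanSpace ℝ (Fin 3), (τ + ‖x - y‖ ^ 2) ^ (-(2 : ℝ)) =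
      ∫ z : EuclideanSpace ℝ (Fin 3), (τ + ‖z‖ ^ 2) ^ (-(2 : ℝ)) :=
    integral_sub_left_eq_self (fun z : EuclideanSpace ℝ (Fin 3) => (τ + ‖z‖ ^ 2) ^ (-(2 : ℝ))) volume x
  have hsub74 : ∫ y : EuclideanSpace ℝ (Fin 3), (τ + ‖x - y‖ ^ 2) ^ (-(7 / 4 : ℝ)) =
      ∫ z : EuclideanSpace ℝ (Fin 3), (τ + ‖z‖ ^ 2) ^ (-(7 / 4 : ℝ)) :=
    integral_sub_left_eq_self (fun z : EuclideanSpace ℝ (Fin 3) => (τ + ‖z‖ ^ 2) ^ (-(7 / 4 : ℝ))) volume x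
  rw [hg]
  dsimp only
  rw [integral_add (hw2.const_mul _) (hw74.const_mul _), MeasureTheory.integral_const_mul,
    MeasureTheory.integral_const_mul, hsub2, hsub74, integral_add_norm_sq_rpow_neg hτ 2,
    integral_add_norm_sq_rpow_neg hτ (7 / 4 : ℝ), finrank_R3_real]
  have e1 : (3 : ℝ) / 2 - 2 = -(1 / 2 : ℝ) := by norm_num
  have e2 : (3 : ℝ) / 2 - 7 / 4 = -(1 / 4 : ℝ) := by norm_num
  rw [e1, e2]
  apply le_of_eq
  ring

end Summit.NavierStokesRegularity.NavierStokesRegularity.Theorems.PoloidalWindowDoorPoloidalWindowRigidityEternalCoreParaboloidGapTools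

end
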